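/-
Origin: expansion seat `planner-pub-hodgecm-pv06-g5-0`, handover #3 2026-08-18T11:34Z md5 7efcfe8031a6 (v2); rewrites Pv10g4.LevelLattice->HodgeCM.PerL34.LevelLattice, Pv06g5.ArchCompactK->HodgeCM.PerL34.ArchCompactK (x2); after pv10-g4 #4 CongruenceLattice (bc51ecd5) + #5 TorsionFreeAction (5c3a79cd) [RUN 28] + #6 LevelLattice (013786633f7f) and pv06-g5 #1 (da40467a4fe9); as-landed aslanded/HodgeCM/PerL34/ArchCompactKFree.lean c2d3b67c5e2f (`HOME/pub-hodgecm-pv06-g5/lean/Pv06g5/ArchCompactKFree.lean`, md5 7efcfe80, 119 lines);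
landed by the gen-8 packager in gate run 29 as `HodgeCM/PerL34/ArchCompactKFree.lean` (import ^import Pv06g5\.ArchCompactK[ \t]*$→import HodgeCM.PerL34.ArchCompactK ×1; import ^import Pv10g4\.LevelLattice[ \t]*$→import HodgeCM.PerL34.LevelLattice ×1; stripped 7 #print/#check/#eval lines).
-/
/-
Origin: pub-hodgecm cell, unit pub-hodgecm-pv06-g5 (DAG-NODE PROVER #06, generation 5), 2026-08-18.
Target path in the package: `HodgeCM/PerL34/ArchCompactKFree.lean`; WIP imports ↦ REWRITE
`import Pv10g4.LevelLattice` ↦ `import HodgeCM.PerL34.LevelLattice` (pv10-g4 RUN-29 row #6, which imports its RUN-28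
row #5 `HodgeCM.PerL34.TorsionFreeAction`) and `import Pv06g5.ArchCompactK` ↦ `import HodgeCM.PerL34.ArchCompactK`
(this seat's row #1).  Lands AFTER pv10-g4 #4/#5/#6 and this seat's #1.

# Congruence subgroups and levels of `G_U` act on `G_U(ℝ)/K_∞` with finite isotropy, freely when torsion-free (KERNEL)

PerL v5 ll. 66–73 ("for torsion-free `Γ`, `P^L_Γ := Γ\𝔹²` is a smooth projective surface"), group level.
pv10-g4's `HodgeCM/PerL34/TorsionFreeAction.lean` (congruence lattices `Γ_{K_f}`) and
`HodgeCM/PerL34/LevelLattice.lean` (every `Λ : HodgeCM.Level V`, the universe's actual index set) prove the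
statements below for an ARBITRARY compact subgroup `C ≤ G_U(ℝ) = Uinf L V.Hm` ("e.g. a maximal compact `K_∞`");
`HodgeCM/PerL34/ArchCompactK.lean` (§4) constructs `K_∞ = HermSpace3.archK V T` (`U(2) × U(1)` in a Sylvester
frame `T` at the place of `ι₁`, `U(3)` at the definite places) and proves it compact with NO hypothesis.  This file
discharges the `(C, hC)` binders (one-line specialisations, added here at pv10-g4's request, STATUS 11:24:33Z):

* `HermSpace3.finite_stabilizer_congruenceLattice_archK` — isotropy groups of `Γ_{K_f} = G_U(L₀) ∩ K_f` on
  `G_U(ℝ)/K_∞` are finite (orbifold statement; any compact `K_f`, any `V`);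
* `HermSpace3.stabilizer_congruenceLattice_archK_eq_bot`, `HermSpace3.smul_eq_self_iff_archK` — a torsion-free
  `Γ_{K_f}` acts freely on `G_U(ℝ)/K_∞` (`γ • x = x ↔ γ = 1`);
* `Level.stabilizer_archLattice_archK_eq_bot`, `Level.smul_eq_self_iff_archK` — for EVERY `Λ : Level V`, its
  archimedean image `Γ_∞ = archLattice L V.Hm Λ.Γ` acts freely on `G_U(ℝ)/K_∞`;
* `HermSpace3.exists_sylvesterFrame_free_action`, `Level.exists_sylvesterFrame_free_action` — the same with the
  Sylvester frame of `HermSpace3.exists_frame_place` packaged existentially (`Tᴴ H^{w₁} T = diag(1,1,-1)`, so that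
  `K_∞ = U(2) × U(1) × ∏ U(3)` in coordinates, `HermSpace3.mem_archK_iff_commute`).

With such a `T` the `w₁`-component of `K_∞` is the conjugate of `Stab_{U(2,1)}(x₀)`, `x₀ ∈ 𝔹²` the base point
(`HodgeCM/PerL34/BallStabilizer.lean`), so these are the group-level free-action statements on `𝔹² × pt`.
Nothing cited, nothing posited, standard axioms (`#print axioms` below).
-/
import Summits.HodgeConjecture.HodgeCM.PerL34.LevelLattice_2
import Summits.HodgeConjecture.HodgeCM.PerL34.ArchCompactK_2

/-! PORT of `HodgeCM/PerL34/ArchCompactKFree.lean` (HodgeCMPerL run 82) — verbatim mechanical port; provenance in the PORT header line. -/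

set_option autoImplicit false

noncomputable section

namespace HodgeCM.PerL34.ArchCompactK

open HodgeCM.PerL34.Godement HodgeCM.PerL34.AdelicUnitaryFactorisation
open Literature.AlgebraicGeometry.ShimuraVarieties (signatureMatrix)

variable (L : CMField) {ι₁ : L →+* ℂ} (V : HermSpace3 L ι₁)

/-- **Orbifold statement on `G_U(ℝ)/K_∞`**: for every compact `K_f ≤ G_U(𝔸_f)` and every frame `T`, the isotropy
groups of the congruence lattice `Γ_{K_f}` acting on `G_U(ℝ)/K_∞`, `K_∞ = HermSpace3.archK V T`, are finite. -/
theorem _root_.HodgeCM.HermSpace3.finite_stabilizer_congruenceLattice_archK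
    (Kf : Subgroup (Ufin L V.Hm)) (hKc : IsCompact (Kf : Set (Ufin L V.Hm))) (T : GL (Fin 3) ℂ)
    (x : Uinf L V.Hm ⧸ V.archK T) :
    Finite (MulAction.stabilizer (Uinf L V.Hm) x ⊓ congruenceLattice L V.Hm Kf : Subgroup (Uinf L V.Hm)) :=
  HodgeCM.HermSpace3.finite_stabilizer_congruenceLattice L V Kf hKc (V.archK T) (V.isCompact_archK T) x

/-- **PerL v5 ll. 72–73, group level, on `G_U(ℝ)/K_∞`**: a torsion-free congruence lattice meets every isotropy
group of `G_U(ℝ)/K_∞` trivially. -/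
theorem _root_.HodgeCM.HermSpace3.stabilizer_congruenceLattice_archK_eq_bot
    (Kf : Subgroup (Ufin L V.Hm)) (hKc : IsCompact (Kf : Set (Ufin L V.Hm)))
    (htf : ∀ γ ∈ congruenceLattice L V.Hm Kf, IsOfFinOrder γ → γ = 1) (T : GL (Fin 3) ℂ)
    (x : Uinf L V.Hm ⧸ V.archK T) :
    MulAction.stabilizer (Uinf L V.Hm) x ⊓ congruenceLattice L V.Hm Kf = ⊥ :=
  HodgeCM.HermSpace3.stabilizer_congruenceLattice_eq_bot L V Kf hKc htf (V.archK T) (V.isCompact_archK T) x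

/-- **Free action**: for `γ` in a torsion-free congruence lattice and `x ∈ G_U(ℝ)/K_∞`, `γ • x = x ↔ γ = 1`. -/
theorem _root_.HodgeCM.HermSpace3.smul_eq_self_iff_archK
    (Kf : Subgroup (Ufin L V.Hm)) (hKc : IsCompact (Kf : Set (Ufin L V.Hm)))
    (htf : ∀ γ ∈ congruenceLattice L V.Hm Kf, IsOfFinOrder γ → γ = 1) (T : GL (Fin 3) ℂ)
    {γ : Uinf L V.Hm} (hγ : γ ∈ congruenceLattice L V.Hm Kf) (x : Uinf L V.Hm ⧸ V.archK T) :
    γ • x = x ↔ γ = 1 :=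
  HodgeCM.HermSpace3.smul_eq_self_iff_of_torsionFree L V Kf hKc htf (V.archK T) (V.isCompact_archK T) hγ x

/-- The same three statements hold for the Sylvester frame produced by `HermSpace3.exists_frame_place` (recorded as an
existential so that consumers need not choose `T`): there is a frame `T` with `Tᴴ H^{w₁} T = diag(1,1,-1)` — so that
`K_∞ = archK V T` is `U(2) × U(1) × ∏ U(3)` in coordinates (`HermSpace3.mem_archK_iff_commute`) — for which every
torsion-free congruence lattice acts freely on `G_U(ℝ)/K_∞`. -/
theorem _root_.HodgeCM.HermSpace3.exists_sylvesterFrame_free_action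
    (Kf : Subgroup (Ufin L V.Hm)) (hKc : IsCompact (Kf : Set (Ufin L V.Hm)))
    (htf : ∀ γ ∈ congruenceLattice L V.Hm Kf, IsOfFinOrder γ → γ = 1) :
    ∃ T : GL (Fin 3) ℂ,
      (T : Matrix (Fin 3) (Fin 3) ℂ).conjTranspose * V.Hm.map (NumberField.InfinitePlace.mk ι₁).embedding * T
          = signatureMatrix 2 ∧
      ∀ x : Uinf L V.Hm ⧸ V.archK T, MulAction.stabilizer (Uinf L V.Hm) x ⊓ congruenceLattice L V.Hm Kf = ⊥ := by
  obtain ⟨T, hT⟩ := V.exists_frame_place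
  exact ⟨T, hT, fun x => V.stabilizer_congruenceLattice_archK_eq_bot L Kf hKc htf T x⟩

/-! ## For every `Λ : Level V` (pv10-g4 `LevelLattice.lean`) -/

/-- **PerL v5 ll. 72–73, group level, for every level `Λ` of the universe**: the archimedean image
`Γ_∞ = archLattice L V.Hm Λ.Γ` of `Λ.Γ` meets every isotropy group of `G_U(ℝ)/K_∞` trivially. -/
theorem _root_.HodgeCM.Level.stabilizer_archLattice_archK_eq_bot (Λ : Level V) (T : GL (Fin 3) ℂ)
    (x : Uinf L V.Hm ⧸ V.archK T) :
    MulAction.stabilizer (Uinf L V.Hm) x ⊓ archLattice L V.Hm Λ.Γ = ⊥ :=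
  HodgeCM.Level.stabilizer_archLattice_eq_bot L V Λ (V.archK T) (V.isCompact_archK T) x

/-- **Free action of every level on `G_U(ℝ)/K_∞`**: `γ • x = x ↔ γ = 1` for `γ ∈ Γ_∞`. -/
theorem _root_.HodgeCM.Level.smul_eq_self_iff_archK (Λ : Level V) (T : GL (Fin 3) ℂ)
    {γ : Uinf L V.Hm} (hγ : γ ∈ archLattice L V.Hm Λ.Γ) (x : Uinf L V.Hm ⧸ V.archK T) :
    γ • x = x ↔ γ = 1 :=
  HodgeCM.Level.smul_eq_self_iff L V Λ (V.archK T) (V.isCompact_archK T) hγ x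

/-- The level version with the Sylvester frame packaged existentially. -/
theorem _root_.HodgeCM.Level.exists_sylvesterFrame_free_action (Λ : Level V) :
    ∃ T : GL (Fin 3) ℂ,
      (T : Matrix (Fin 3) (Fin 3) ℂ).conjTranspose * V.Hm.map (NumberField.InfinitePlace.mk ι₁).embedding * T
          = signatureMatrix 2 ∧
      ∀ x : Uinf L V.Hm ⧸ V.archK T, MulAction.stabilizer (Uinf L V.Hm) x ⊓ archLattice L V.Hm Λ.Γ = ⊥ := by
  obtain ⟨T, hT⟩ := V.exists_frame_place
  exact ⟨T, hT, fun x => Λ.stabilizer_archLattice_archK_eq_bot L V T x⟩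

end HodgeCM.PerL34.ArchCompactK

end

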